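import Summits.BirchSwinnertonDyer.BirchSwinnertonDyer.Theorems.SignedLowerHalvesSmallImageLowerHalfBothSignsRttD2J2DeltaLevel
import Summits.BirchSwinnertonDyer.BirchSwinnertonDyer.Theorems.SignedLowerHalvesSmallImageLowerHalfBothSignsRttD2J2Corestriction
import HarnessLib

/-!
# Route `SignedLowerHalves`, crux L `SmallImageLowerHalfBothSigns` (stmt-BirchSwinnertonDyer-23599), line `rtt_w3` v15 — E2, junction row J2,
# research half «δ₁», brick (δ-d3): THE LEVEL CONNECTING MAPS `d_{n,k,m} : H¹(G_S(K^{(1)}_m), X_k) → H²(G_S(K̃_n), X_k)` (`n + k ≤ m`)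
# IN HONDA'S CURRENCY, and their laws against `spLevel` / `layerCoresO` / `cycLayerCoresO` / `layerRedO` / `layerScalarO` / `layerConjO`

INPUTS hand `bsd-inputs-honda-p1` g24 under LEAD `cruxlead-stmt-BirchSwinnertonDyer-23599` g11 (v15.1, stub B `stub_charRoadJunction_ns`, row J2; the J2 socket p786107 wants
`δ₁ : I.H →+ D₂.H[C X]`, `hδ₁`, `hex₁`). ★★ `dLevel … k hnkm : cycLayerCohO S κ₁ θ (suppPF p 𝔣) m k 1 →+ layerCohO S κ₁ κ₂ θ 𝔣 n k 2` := `sh ∘ dPerm ∘ sh⁻¹`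
(bricks (δ-c), (δ-d2)), with `dPerm`'s hypotheses discharged by brick (δ-d1) from `γ₂ ∈ ker κ₁`, `κ₂ γ₂ ∈ ℤ_pˣ`, `N_{p𝔣} ≤ Gal(K̄/K̃_m)`. LAWS (one line each from (c1)–(c7)
through the dictionary `shO_coindFinSum` / `shO_rTransHom_one/_two` / `shO_red` / `shO_scalar`):
* (L1) `dLevel_spLevel` — `d ∘ cor_{K̃_m/K^{(1)}_m} = 0`; (L2) `layerConjO_dLevel_self` — `γ₂ · d x = d x` (the image is killed by `T₂ = conj_{γ₂} − 1`);
* (L3) `layerCoresO_dLevel` — `cor_{K̃_{n+1}/K̃_n} ∘ d_{n+1} = d_n`; (L4) `dLevel_cycLayerCoresO` — `d_{·,m} ∘ cor_{K^{(1)}_{m+1}/K^{(1)}_m} = d_{·,m+1}`;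
* (L5) `layerRedO_dLevel` — reductions; (L6) `layerScalarO_dLevel` — `𝒪`-linearity; (L7) `layerConjO_dLevel` — `γ · d x = d (γ · x)` for EVERY `γ ∈ Γ_K`;
* (L8) ★ `exists_spLevel_eq_of_dLevel_eq_zero` — EXACTNESS TRANSFER: `d_{n,k,m} x = 0 ⇒ cor_{K^{(1)}_m/K^{(1)}_n} x ∈ range cor_{K̃_n/K^{(1)}_n}`.
Brick (δ-e) assembles these into `δ₁ : I.H →+ torsionBy Λ_{𝒪,2} D₂.H (C X)` with `hδ₁`, brick (δ-f) proves `hex₁`.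
DEFINITIONS WITH BODIES (`dLevel`) + THEOREMS (`--supports stmt-BirchSwinnertonDyer-23599` helper); no named fact, no `sorry`; the instance recipes of brick (δ-d2) are
LOCAL instances of this file; crux L, crux M, E2 and BSD remain OPEN and are proved for NO curve by any of this.
References: [PerrinRiou1994Invent] §1.3; [JohnsonLeungKings2011] §4.2 Def. 4.2 (94), Lemma 4.4; [SerreGaloisCohomology1997] I §2.2–§2.5; [NeukirchSchmidtWingberg2008] (1.3.2)–(1.3.3), I §5–§6.
-/

set_option autoImplicit false
-- the Theorems namespace of this sub repeats the summit name by design (D-0017 nested layout)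
set_option linter.dupNamespace false

noncomputable section

open scoped NumberField
open CategoryTheory Field IsDedekindDomain
open Literature.NumberTheory.GaloisRepresentations
open Literature.NumberTheory.EllipticCurves
open Literature.NumberTheory.ComplexMultiplication.EllipticUnits.JohnsonLeungKings2011
open Summit.BirchSwinnertonDyer.BirchSwinnertonDyer.Theorems.SmallImageRttD2J1
open Summit.BirchSwinnertonDyer.BirchSwinnertonDyer.Theorems.SmallImageRttD2J2

namespace Summit.BirchSwinnertonDyer.BirchSwinnertonDyer.Theorems.SmallImageRttD2J2Delta

variable {K : Type} [Field K] [NumberField K] {p : ℕ} [Fact p.Prime] (S : Set (PadicAlgCl p)) [FiniteDimensional ℚ_[p] (padicCoeffField S)]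
  (κ₁ κ₂ : ZpExtension K p) {γ₂ : absoluteGaloisGroup K} (θ : absoluteGaloisGroup K →ₜ* (padicCoeffIntegers S)ˣ) (𝔣 : Ideal (𝓞 K))

omit [NumberField K] in
/-- The coefficients `X_k = (𝒪 ⊗ μ_{p^k} ⊗ θ)^{N_P}` are finite (the module type under `coeffGSO`). [cite: JohnsonLeungKings2011, Def. 4.2 (arXiv p0012:L80–95)] -/
theorem finite_invariantsOf_muTwistO (P : Set (HeightOneSpectrum (𝓞 K))) (k : ℕ) : Finite ((muTwistO S θ k).invariantsOf (ramificationSubgroup K P)) := by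
  haveI := SmallImageRttD2Seq.finite_oMuCarrier (K := K) S k
  exact Subtype.finite

attribute [local instance] totallyDisconnectedSpace_GS normal_imGS fintypeQuotLayer fintypeQuotPairLayer fintypeQuotPairInfLayer finite_invariantsOf_muTwistO

omit [NumberField K] in
/-- `Gal(K̄/K̃_m) ≤ Gal(K̄/K̃_n)` for `n ≤ m`. [cite: JohnsonLeungKings2011, §4.1 (arXiv p0012:L12–14)] -/
theorem pairLayerSubgroup_le {n m : ℕ} (h : n ≤ m) : pairLayerSubgroup κ₁ κ₂ m ≤ pairLayerSubgroup κ₁ κ₂ n :=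
  pairLayerSubgroup_antitone κ₁ κ₂ h

omit [NumberField K] in
/-- `Gal(K̄/K_m) ≤ Gal(K̄/K_n)` for `n ≤ m`. [cite: Washington1997, §13.1] -/
theorem layerSubgroup_le (κ : ZpExtension K p) {n m : ℕ} (h : n ≤ m) : κ.layerSubgroup m ≤ κ.layerSubgroup n :=
  κ.layerSubgroup_antitone h

section Def

variable (hγ₁ : γ₂ ∈ κ₁.kerSubgroup) (hγu : IsUnit (κ₂ γ₂).toAdd) (hV : ∀ m : ℕ, ramificationSubgroup K (suppPF p 𝔣) ≤ pairLayerSubgroup κ₁ κ₂ m)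

/-- ★★ **THE LEVEL CONNECTING MAP `d_{n,k,m} : H¹(G_S(K^{(1)}_m), X_k) → H²(G_S(K̃_n), X_k)`** (`n + k ≤ m`): `sh_{V̄_n} ∘ dPerm ∘ sh_{Ū_m}⁻¹` for the finite-level SES
`0 → ker Σ_m → Maps(G_S ⧸ V̄_m, X_k) → Maps(G_S ⧸ Ū_m, X_k) → 0` and the wrong-way map `ker Σ_m → Maps(G_S ⧸ V̄_n, X_k)` (`[V̄_n ⊓ Ū_m : V̄_m] = p^{m−n} ≥ p^k` kills `X_k`).
[cite: PerrinRiou1994Invent, §1.3] [cite: SerreGaloisCohomology1997, I §2.2–§2.5] [cite: JohnsonLeungKings2011, §4.2 Def. 4.2 (94)] -/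
def dLevel (k : ℕ) {n m : ℕ} (hnkm : n + k ≤ m) : cycLayerCohO S κ₁ θ (suppPF p 𝔣) m k 1 →+ layerCohO S κ₁ κ₂ θ 𝔣 n k 2 :=
  (shO S (suppPF p 𝔣) θ (isOpen_pairLayerSubgroup κ₁ κ₂ n) k 2).toAddMonoidHom.comp
    ((dPerm (coeffGSO S (suppPF p 𝔣) θ k)
        (imGS_le_of_le (suppPF p 𝔣) (inf_le_left : pairLayerSubgroup κ₁ κ₂ m ≤ κ₁.layerSubgroup m))
        (imGS_le_of_le (suppPF p 𝔣) (pairLayerSubgroup_le κ₁ κ₂ (le_trans (Nat.le_add_right n k) hnkm)))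
        (toUnramifiedQuot K (suppPF p 𝔣) γ₂)
        (isOpen_imGS_of_isOpen (suppPF p 𝔣) (κ₁.isOpen_layerSubgroup m)) (isOpen_imGS_of_isOpen (suppPF p 𝔣) (isOpen_pairLayerSubgroup κ₁ κ₂ m))
        (toUnramifiedQuot_mem_imGS (suppPF p 𝔣) (κ₁.kerSubgroup_le_layerSubgroup m hγ₁))
        (exists_eq_mul_pow_of_proj_eq (suppPF p 𝔣) κ₁ κ₂ hγ₁ hγu m)
        (index_smul_eq_zero (suppPF p 𝔣) κ₁ κ₂ S θ hγ₁ hγu hnkm (hV m))).comp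
      (shO S (suppPF p 𝔣) θ (κ₁.isOpen_layerSubgroup m) k 1).symm.toAddMonoidHom)

/-- Unfolding `dLevel`. [cite: PerrinRiou1994Invent, §1.3] -/
theorem dLevel_apply (k : ℕ) {n m : ℕ} (hnkm : n + k ≤ m) (x : cycLayerCohO S κ₁ θ (suppPF p 𝔣) m k 1) :
    dLevel S κ₁ κ₂ θ 𝔣 hγ₁ hγu hV k hnkm x = shO S (suppPF p 𝔣) θ (isOpen_pairLayerSubgroup κ₁ κ₂ n) k 2
      (dPerm (coeffGSO S (suppPF p 𝔣) θ k)
        (imGS_le_of_le (suppPF p 𝔣) (inf_le_left : pairLayerSubgroup κ₁ κ₂ m ≤ κ₁.layerSubgroup m))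
        (imGS_le_of_le (suppPF p 𝔣) (pairLayerSubgroup_le κ₁ κ₂ (le_trans (Nat.le_add_right n k) hnkm)))
        (toUnramifiedQuot K (suppPF p 𝔣) γ₂)
        (isOpen_imGS_of_isOpen (suppPF p 𝔣) (κ₁.isOpen_layerSubgroup m)) (isOpen_imGS_of_isOpen (suppPF p 𝔣) (isOpen_pairLayerSubgroup κ₁ κ₂ m))
        (toUnramifiedQuot_mem_imGS (suppPF p 𝔣) (κ₁.kerSubgroup_le_layerSubgroup m hγ₁))
        (exists_eq_mul_pow_of_proj_eq (suppPF p 𝔣) κ₁ κ₂ hγ₁ hγu m)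
        (index_smul_eq_zero (suppPF p 𝔣) κ₁ κ₂ S θ hγ₁ hγu hnkm (hV m))
        ((shO S (suppPF p 𝔣) θ (κ₁.isOpen_layerSubgroup m) k 1).symm x)) := rfl

/-- (L1) **`d ∘ cor_{K̃_m/K^{(1)}_m} = 0`** (`spLevel` = `relCoresO` = `sh ∘ H¹(Σ_m) ∘ sh⁻¹`; brick (δ-c) (c1)). [cite: SerreGaloisCohomology1997, I §2.2] [cite: NeukirchSchmidtWingberg2008, (1.3.2)] -/
theorem dLevel_spLevel (k : ℕ) {n m : ℕ} (hnkm : n + k ≤ m) (y : layerCohO S κ₁ κ₂ θ 𝔣 m k 1) :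
    dLevel S κ₁ κ₂ θ 𝔣 hγ₁ hγu hV k hnkm (spLevel S κ₁ κ₂ θ 𝔣 m k 1 y) = 0 := by
  rw [dLevel_apply]
  set w := (shO S (suppPF p 𝔣) θ (isOpen_pairLayerSubgroup κ₁ κ₂ m) k 1).symm y with hw
  have hy : spLevel S κ₁ κ₂ θ 𝔣 m k 1 y = shO S (suppPF p 𝔣) θ (κ₁.isOpen_layerSubgroup m) k 1
      (cohomologyMap (coindFinSum (coeffGSO S (suppPF p 𝔣) θ k).toTopRep
        (imGS_le_of_le (suppPF p 𝔣) (inf_le_left : pairLayerSubgroup κ₁ κ₂ m ≤ κ₁.layerSubgroup m))) 1 w) := by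
    rw [shO_coindFinSum, hw, AddEquiv.apply_symm_apply]; rfl
  rw [hy, AddEquiv.symm_apply_apply, dPerm_map_one, map_zero]

/-- (L2) **`γ₂ · d x = d x`**: the image of `d_{n,k,m}` is fixed by `conj_{γ₂}` (brick (δ-c) (c2) + `shO_rTransHom_two`). [cite: PerrinRiou1994Invent, §1.3] [cite: SerreLocalFields1979, VII §5] -/
theorem layerConjO_dLevel_self (k : ℕ) {n m : ℕ} (hnkm : n + k ≤ m) (x : cycLayerCohO S κ₁ θ (suppPF p 𝔣) m k 1) :
    layerConjO S κ₁ κ₂ θ 𝔣 n k 2 γ₂ (dLevel S κ₁ κ₂ θ 𝔣 hγ₁ hγu hV k hnkm x) = dLevel S κ₁ κ₂ θ 𝔣 hγ₁ hγu hV k hnkm x := by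
  rw [dLevel_apply, layerConjO, ← shO_rTransHom_two, rTransHom_dPerm]

/-- (L3) **`cor_{K̃_{n+1}/K̃_n} (d_{n+1,k,m} x) = d_{n,k,m} x`** (brick (δ-c) (c3) + `shO_coindFinSum`). [cite: NeukirchSchmidtWingberg2008, I §5 Prop. (1.5.3)] -/
theorem layerCoresO_dLevel (k : ℕ) {n m : ℕ} (hnkm : n + 1 + k ≤ m) (hnkm' : n + k ≤ m) (x : cycLayerCohO S κ₁ θ (suppPF p 𝔣) m k 1) :
    layerCoresO S κ₁ κ₂ θ 𝔣 n k 2 (dLevel S κ₁ κ₂ θ 𝔣 hγ₁ hγu hV k hnkm x) = dLevel S κ₁ κ₂ θ 𝔣 hγ₁ hγu hV k hnkm' x := by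
  rw [dLevel_apply, dLevel_apply, layerCoresO, ← shO_coindFinSum, coindFinSum_dPerm]

/-- (L4) **`d_{n,k,m} (cor_{K^{(1)}_{m+1}/K^{(1)}_m} x') = d_{n,k,m+1} x'`** (brick (δ-c) (c4): naturality of `δ₁` + transitivity of the wrong-way maps; `cycLayerCoresO` = `relCoresO`).
[cite: NeukirchSchmidtWingberg2008, (1.3.3), I §5 Prop. (1.5.3)] -/
theorem dLevel_cycLayerCoresO (k : ℕ) {n m : ℕ} (hnkm : n + k ≤ m) (hnkm' : n + k ≤ m + 1) (x' : cycLayerCohO S κ₁ θ (suppPF p 𝔣) (m + 1) k 1) :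
    dLevel S κ₁ κ₂ θ 𝔣 hγ₁ hγu hV k hnkm (cycLayerCoresO S κ₁ θ (suppPF p 𝔣) m k 1 x') = dLevel S κ₁ κ₂ θ 𝔣 hγ₁ hγu hV k hnkm' x' := by
  rw [dLevel_apply, dLevel_apply]
  set w := (shO S (suppPF p 𝔣) θ (κ₁.isOpen_layerSubgroup (m + 1)) k 1).symm x' with hw
  have hx : cycLayerCoresO S κ₁ θ (suppPF p 𝔣) m k 1 x' = shO S (suppPF p 𝔣) θ (κ₁.isOpen_layerSubgroup m) k 1
      (cohomologyMap (coindFinSum (coeffGSO S (suppPF p 𝔣) θ k).toTopRep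
        (imGS_le_of_le (suppPF p 𝔣) (layerSubgroup_le κ₁ (Nat.le_succ m) : κ₁.layerSubgroup (m + 1) ≤ κ₁.layerSubgroup m))) 1 w) := by
    rw [shO_coindFinSum, hw, AddEquiv.apply_symm_apply]; rfl
  rw [hx, AddEquiv.symm_apply_apply]
  exact congrArg (shO S (suppPF p 𝔣) θ (isOpen_pairLayerSubgroup κ₁ κ₂ n) k 2)
    (dPerm_coindFinSum (coeffGSO S (suppPF p 𝔣) θ k)
      (h'' := imGS_le_of_le (suppPF p 𝔣) (inf_le_left : pairLayerSubgroup κ₁ κ₂ (m + 1) ≤ κ₁.layerSubgroup (m + 1)))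
      (h' := imGS_le_of_le (suppPF p 𝔣) (inf_le_left : pairLayerSubgroup κ₁ κ₂ m ≤ κ₁.layerSubgroup m))
      (hVV' := imGS_le_of_le (suppPF p 𝔣) (pairLayerSubgroup_le κ₁ κ₂ (Nat.le_succ m) : pairLayerSubgroup κ₁ κ₂ (m + 1) ≤ pairLayerSubgroup κ₁ κ₂ m))
      (hUU' := imGS_le_of_le (suppPF p 𝔣) (layerSubgroup_le κ₁ (Nat.le_succ m) : κ₁.layerSubgroup (m + 1) ≤ κ₁.layerSubgroup m))
      (hVV := imGS_le_of_le (suppPF p 𝔣) (pairLayerSubgroup_le κ₁ κ₂ (le_trans (Nat.le_add_right n k) hnkm)))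
      (c := toUnramifiedQuot K (suppPF p 𝔣) γ₂)
      (hU'' := isOpen_imGS_of_isOpen (suppPF p 𝔣) (κ₁.isOpen_layerSubgroup (m + 1))) (hU' := isOpen_imGS_of_isOpen (suppPF p 𝔣) (κ₁.isOpen_layerSubgroup m))
      (hV'' := isOpen_imGS_of_isOpen (suppPF p 𝔣) (isOpen_pairLayerSubgroup κ₁ κ₂ (m + 1)))
      (hV' := isOpen_imGS_of_isOpen (suppPF p 𝔣) (isOpen_pairLayerSubgroup κ₁ κ₂ m))
      (hc' := toUnramifiedQuot_mem_imGS (suppPF p 𝔣) (κ₁.kerSubgroup_le_layerSubgroup m hγ₁))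
      (hc'' := toUnramifiedQuot_mem_imGS (suppPF p 𝔣) (κ₁.kerSubgroup_le_layerSubgroup (m + 1) hγ₁))
      (hgen' := exists_eq_mul_pow_of_proj_eq (suppPF p 𝔣) κ₁ κ₂ hγ₁ hγu m) (hgen'' := exists_eq_mul_pow_of_proj_eq (suppPF p 𝔣) κ₁ κ₂ hγ₁ hγu (m + 1))
      (hidx' := index_smul_eq_zero (suppPF p 𝔣) κ₁ κ₂ S θ hγ₁ hγu hnkm (hV m))
      (hidx'' := index_smul_eq_zero (suppPF p 𝔣) κ₁ κ₂ S θ hγ₁ hγu hnkm' (hV (m + 1))) w)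

/-- (L5) **Reductions**: `red (d_{n,k+1,m} x) = d_{n,k,m} (red x)` (brick (δ-c) (c5) + `shO_red`). [cite: Kato2004Asterisque, §8.2 (p. 180)] [cite: NeukirchSchmidtWingberg2008, (1.3.3)] -/
theorem layerRedO_dLevel (k : ℕ) {n m : ℕ} (hnkm : n + (k + 1) ≤ m) (hnkm' : n + k ≤ m) (x : cycLayerCohO S κ₁ θ (suppPF p 𝔣) m (k + 1) 1) :
    layerRedO S κ₁ κ₂ θ 𝔣 n k 2 (dLevel S κ₁ κ₂ θ 𝔣 hγ₁ hγu hV (k + 1) hnkm x) =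
      dLevel S κ₁ κ₂ θ 𝔣 hγ₁ hγu hV k hnkm' (cycLayerRedO S κ₁ θ (suppPF p 𝔣) m k 1 x) := by
  rw [dLevel_apply, dLevel_apply]
  set w := (shO S (suppPF p 𝔣) θ (κ₁.isOpen_layerSubgroup m) (k + 1) 1).symm x with hw
  -- source: `sh⁻¹ (red x) = H¹(Maps(red)) (sh⁻¹ x)`
  have hsrc : (shO S (suppPF p 𝔣) θ (κ₁.isOpen_layerSubgroup m) k 1).symm (cycLayerRedO S κ₁ θ (suppPF p 𝔣) m k 1 x) =
      cohomologyMap (coindFinMap (coeffMapHomO S (suppPF p 𝔣) θ (oMuRed S k) (oMuRed_muTwistO S θ k)) (imGS (suppPF p 𝔣) (κ₁.layerSubgroup m))) 1 w := by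
    rw [AddEquiv.symm_apply_eq, shO_red, hw, AddEquiv.apply_symm_apply]; rfl
  rw [hsrc]
  -- target: `red (sh z) = sh (H²(Maps(red)) z)`, then (c5)
  refine ((shO_red S (suppPF p 𝔣) θ (isOpen_pairLayerSubgroup κ₁ κ₂ n) k 2 _).symm.trans (congrArg _ ?_) :)
  exact coindFinMap_dPerm (coeffGSO S (suppPF p 𝔣) θ (k + 1)) (coeffGSO S (suppPF p 𝔣) θ k)
    (coeffMapHomO S (suppPF p 𝔣) θ (oMuRed S k) (oMuRed_muTwistO S θ k)) _ _ _ _ _ _ _ _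
    (index_smul_eq_zero (suppPF p 𝔣) κ₁ κ₂ S θ hγ₁ hγu hnkm' (hV m)) w

/-- (L6) **`𝒪`-linearity**: `c · d x = d (c · x)` (brick (δ-c) (c5) + `shO_scalar`). [cite: JohnsonLeungKings2011, §4.1 Def. 4.1 (arXiv p0012:L59–60)] -/
theorem layerScalarO_dLevel (k : ℕ) {n m : ℕ} (hnkm : n + k ≤ m) (c : padicCoeffIntegers S) (x : cycLayerCohO S κ₁ θ (suppPF p 𝔣) m k 1) :
    layerScalarO S κ₁ κ₂ θ 𝔣 n k 2 c (dLevel S κ₁ κ₂ θ 𝔣 hγ₁ hγu hV k hnkm x) =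
      dLevel S κ₁ κ₂ θ 𝔣 hγ₁ hγu hV k hnkm (cycLayerScalarO S κ₁ θ (suppPF p 𝔣) m k 1 c x) := by
  rw [dLevel_apply, dLevel_apply]
  set w := (shO S (suppPF p 𝔣) θ (κ₁.isOpen_layerSubgroup m) k 1).symm x with hw
  have hsrc : (shO S (suppPF p 𝔣) θ (κ₁.isOpen_layerSubgroup m) k 1).symm (cycLayerScalarO S κ₁ θ (suppPF p 𝔣) m k 1 c x) =
      cohomologyMap (coindFinMap (coeffMapHomO S (suppPF p 𝔣) θ (oMuScalar S (p ^ k) c) (oMuScalar_muTwistO S θ k c))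
        (imGS (suppPF p 𝔣) (κ₁.layerSubgroup m))) 1 w := by
    rw [AddEquiv.symm_apply_eq, shO_scalar, hw, AddEquiv.apply_symm_apply]; rfl
  rw [hsrc]
  refine ((shO_scalar S (suppPF p 𝔣) θ (isOpen_pairLayerSubgroup κ₁ κ₂ n) k 2 c _).symm.trans (congrArg _ ?_) :)
  exact coindFinMap_dPerm (coeffGSO S (suppPF p 𝔣) θ k) (coeffGSO S (suppPF p 𝔣) θ k)
    (coeffMapHomO S (suppPF p 𝔣) θ (oMuScalar S (p ^ k) c) (oMuScalar_muTwistO S θ k c)) _ _ _ _ _ _ _ _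
    (index_smul_eq_zero (suppPF p 𝔣) κ₁ κ₂ S θ hγ₁ hγu hnkm (hV m)) w

/-- (L7) **`γ · d x = d (γ · x)` for every `γ ∈ Γ_K`** (brick (δ-c) (c6): `[γ, γ₂] ∈ Gal(K̄/K̃_∞)`; `shO_rTransHom_one/_two`). [cite: SerreLocalFields1979, VII §5] [cite: NeukirchSchmidtWingberg2008, I §6 Prop. (1.6.5)] -/
theorem layerConjO_dLevel (k : ℕ) {n m : ℕ} (hnkm : n + k ≤ m) (γ : absoluteGaloisGroup K) (x : cycLayerCohO S κ₁ θ (suppPF p 𝔣) m k 1) :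
    layerConjO S κ₁ κ₂ θ 𝔣 n k 2 γ (dLevel S κ₁ κ₂ θ 𝔣 hγ₁ hγu hV k hnkm x) =
      dLevel S κ₁ κ₂ θ 𝔣 hγ₁ hγu hV k hnkm (cycLayerConjO S κ₁ θ (suppPF p 𝔣) m k 1 γ x) := by
  rw [dLevel_apply, dLevel_apply]
  set w := (shO S (suppPF p 𝔣) θ (κ₁.isOpen_layerSubgroup m) k 1).symm x with hw
  have hsrc : (shO S (suppPF p 𝔣) θ (κ₁.isOpen_layerSubgroup m) k 1).symm (cycLayerConjO S κ₁ θ (suppPF p 𝔣) m k 1 γ x) =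
      cohomologyMap (rTransHom (coeffGSO S (suppPF p 𝔣) θ k).toTopRep (imGS (suppPF p 𝔣) (κ₁.layerSubgroup m))
        (QuotientGroup.mk (toUnramifiedQuot K (suppPF p 𝔣) γ) : GaloisGroupUnramifiedOutside K (suppPF p 𝔣) ⧸ imGS (suppPF p 𝔣) (κ₁.layerSubgroup m))) 1 w := by
    rw [AddEquiv.symm_apply_eq, shO_rTransHom_one, hw, AddEquiv.apply_symm_apply]; rfl
  rw [hsrc]
  refine ((shO_rTransHom_two S (suppPF p 𝔣) θ (isOpen_pairLayerSubgroup κ₁ κ₂ n) k γ _).symm.trans (congrArg _ ?_) :)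
  exact rTransHom_dPerm_conj (coeffGSO S (suppPF p 𝔣) θ k) _ _ _ _ _ _ _ _ (toUnramifiedQuot K (suppPF p 𝔣) γ)
    (mk_toUnramifiedQuot_mul_comm (suppPF p 𝔣) κ₁ κ₂ m γ γ₂) w

/-- (L8) ★ **EXACTNESS TRANSFER in honda's currency**: if `d_{n,k,m} x = 0` then `cor_{K^{(1)}_m/K^{(1)}_n} x = cor_{K̃_n/K^{(1)}_n} y` for some `y ∈ H¹(G_S(K̃_n), X_k)`
(brick (δ-c) (c7) + `shO_coindFinSum` thrice). [cite: SerreGaloisCohomology1997, I §2.2–§2.3] [cite: PerrinRiou1994Invent, §1.3] -/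
theorem exists_spLevel_eq_of_dLevel_eq_zero (k : ℕ) {n m : ℕ} (hnkm : n + k ≤ m) (x : cycLayerCohO S κ₁ θ (suppPF p 𝔣) m k 1)
    (hx : dLevel S κ₁ κ₂ θ 𝔣 hγ₁ hγu hV k hnkm x = 0) :
    ∃ y : layerCohO S κ₁ κ₂ θ 𝔣 n k 1, spLevel S κ₁ κ₂ θ 𝔣 n k 1 y =
      relCoresO S (suppPF p 𝔣) θ (layerSubgroup_le κ₁ (le_trans (Nat.le_add_right n k) hnkm)) (κ₁.isOpen_layerSubgroup n)
        (κ₁.isOpen_layerSubgroup m) k 1 x := by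
  have hnm : n ≤ m := le_trans (Nat.le_add_right n k) hnkm
  rw [dLevel_apply, AddEquiv.map_eq_zero_iff] at hx
  obtain ⟨w, hw⟩ := exists_coindFinSum_eq_of_dPerm_eq_zero (coeffGSO S (suppPF p 𝔣) θ k)
    (imGS_le_of_le (suppPF p 𝔣) (inf_le_left : pairLayerSubgroup κ₁ κ₂ m ≤ κ₁.layerSubgroup m))
    (imGS_le_of_le (suppPF p 𝔣) (inf_le_left : pairLayerSubgroup κ₁ κ₂ n ≤ κ₁.layerSubgroup n))
    (imGS_le_of_le (suppPF p 𝔣) (pairLayerSubgroup_le κ₁ κ₂ hnm))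
    (imGS_le_of_le (suppPF p 𝔣) (layerSubgroup_le κ₁ hnm))
    (toUnramifiedQuot K (suppPF p 𝔣) γ₂)
    (isOpen_imGS_of_isOpen (suppPF p 𝔣) (κ₁.isOpen_layerSubgroup m)) (isOpen_imGS_of_isOpen (suppPF p 𝔣) (isOpen_pairLayerSubgroup κ₁ κ₂ m))
    (isOpen_imGS_of_isOpen (suppPF p 𝔣) (κ₁.isOpen_layerSubgroup n)) (isOpen_imGS_of_isOpen (suppPF p 𝔣) (isOpen_pairLayerSubgroup κ₁ κ₂ n))
    (toUnramifiedQuot_mem_imGS (suppPF p 𝔣) (κ₁.kerSubgroup_le_layerSubgroup m hγ₁))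
    (toUnramifiedQuot_mem_imGS (suppPF p 𝔣) (κ₁.kerSubgroup_le_layerSubgroup n hγ₁))
    (exists_eq_mul_pow_of_proj_eq (suppPF p 𝔣) κ₁ κ₂ hγ₁ hγu m)
    (index_smul_eq_zero (suppPF p 𝔣) κ₁ κ₂ S θ hγ₁ hγu hnkm (hV m)) _ hx
  refine ⟨shO S (suppPF p 𝔣) θ (isOpen_pairLayerSubgroup κ₁ κ₂ n) k 1 w, ?_⟩
  have h1 := shO_coindFinSum S (suppPF p 𝔣) θ (inf_le_left : pairLayerSubgroup κ₁ κ₂ n ≤ κ₁.layerSubgroup n) (κ₁.isOpen_layerSubgroup n)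
    (isOpen_pairLayerSubgroup κ₁ κ₂ n) k 1 w
  have h2 := shO_coindFinSum S (suppPF p 𝔣) θ (layerSubgroup_le κ₁ hnm) (κ₁.isOpen_layerSubgroup n) (κ₁.isOpen_layerSubgroup m) k 1
    ((shO S (suppPF p 𝔣) θ (κ₁.isOpen_layerSubgroup m) k 1).symm x)
  rw [AddEquiv.apply_symm_apply] at h2
  rw [spLevel]
  exact h1.symm.trans ((congrArg _ hw).trans h2)

end Def

end Summit.BirchSwinnertonDyer.BirchSwinnertonDyer.Theorems.SmallImageRttD2J2Delta

end
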